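import Summits.Ventures.Crystal3D.Theorems.StickyWulffConstantTextureLiminfTexShadowColumnLabel
import Summits.Ventures.Crystal3D.Theorems.StickyWulffConstantCoaxialWallLawEndRowDefs
import HarnessLib

/-!
# The column word lemma, VII: EVENT-CURRENCY GLUE — a twin READING launches the next level anchored in the affine twin
# (input (I5) ↔ the (β) level ledger in event currency, cf-p1 RULINGS (ccl)/(ccliii); lane T `TexShadow`, registered stub `stub_terraceCensus`)

HONEST FRAMING. Venture `Summits/Ventures/Crystal3D` (cell `crystal3d-full`), route `route-Ventures-StickyWulffConstant`, helper `--supports` the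
law-v5 crux `TextureLiminfV5` (stmt-Ventures-23912), lane T, mechanism (β); 19480-p2 g15.  Three one-step corollaries of …TexShadowColumnLabel in the
vocabulary of the event ledger (…TexShadowLevelLedgerEvents{,Star}, 19480-p1 g19: `IsMenuNormal`, `IsTwinReading`, `IsFull` of …CoaxialWallLawEndRowDefs);
census-free, standard axioms, poison-clean; F-C1 not moved.

THE POINT (the (I5) ↔ (I6) interface by name).  The event ledger's reads are TWIN READINGS `IsTwinReading X A n r` (own nine occupied, the three
mirror balls occupied, far slots empty) of the lamella frame `A`; the next level is launched from `r` INTO the far lamella along a polar slot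
(`star_occupied_of_twinReading_mirrorLaunch`).  In the affine currency of `column_theorem`:
* `anchored_of_twinReading_cross` — if `r ∈ (A· + t)''Λ₀` is a twin reading of `(A, n)`, the launched mirror ball `r + twinFrame A n w` (`⟪A w, n⟫ < 0`)
  is ANCHORED in the affine twin `(twinFrame A n · + (t + 2⟪r − t, n⟫ n))''Λ₀` — one located letter of the chain, mirror ball `b = r`;
* `anchored_of_twinReading_glide` — an in-plane step from a reading stays anchored in BOTH lattices (glide-read / in-plane turn: no letter);
* `anchored_of_isFull_step` — a step from a FULL ball stays anchored in the same affine lattice.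
WHAT THIS IS NOT: any count or energy statement; F-C1 not moved.
-/

noncomputable section

namespace Summit.Ventures.Crystal3D.Theorems

namespace ColumnWord

open Finset Summit.Ventures.Crystal3D
open Summit.Ventures.Crystal3D.Cruxes.TextureLiminf.TexShadow (E3 fccRef)
open scoped InnerProductSpace

variable {X : Finset (EuclideanSpace ℝ (Fin 3))}

/-- **CROSS-READ ⇒ next level anchored in the affine twin.**  A twin reading `r ∈ X` of `(A, n)` lying on the affine lattice `(A· + t)''Λ₀`, and a
polar slot `w` (`⟪A w, n⟫ < 0`): the launched ball `r + twinFrame A n w` lies in `(twinFrame A n · + (t + 2⟪r − t, n⟫ n))''Λ₀` and owns three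
linearly independent exact slot neighbours in the twin frame. -/
theorem anchored_of_twinReading_cross (A : EuclideanSpace ℝ (Fin 3) ≃ₗᵢ[ℝ] EuclideanSpace ℝ (Fin 3)) {t r n : EuclideanSpace ℝ (Fin 3)}
    (hread : IsTwinReading X A n r) (hrL : r ∈ (fun q => A q + t) '' fccRef) (hr : r ∈ X)
    {w : EuclideanSpace ℝ (Fin 3)} (hw : w ∈ fccSlots) (hwn : ⟪A w, n⟫_ℝ < 0) :
    r + twinFrame A n w ∈ (fun q => twinFrame A n q + (t + (2 * ⟪r - t, n⟫_ℝ) • n)) '' fccRef ∧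
      ∃ a ∈ fccSlots, ∃ b ∈ fccSlots, ∃ c ∈ fccSlots, LinearIndependent ℝ ![a, b, c] ∧
        r + twinFrame A n w + twinFrame A n a ∈ X ∧ r + twinFrame A n w + twinFrame A n b ∈ X ∧
        r + twinFrame A n w + twinFrame A n c ∈ X := by
  obtain ⟨⟨hn, hmenu⟩, hown, hmirror, -⟩ := hread
  obtain ⟨-, hmem, hanch⟩ := anchored_of_crossing A hrL hr hn hmenu hown hmirror hw hwn
  exact ⟨hmem, hanch⟩

/-- **GLIDE-READ / IN-PLANE TURN ⇒ anchored in both lattices.**  A twin reading `r` of `(A, n)` on `(A· + t)''Λ₀` and an in-plane slot `w`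
(`⟪A w, n⟫ = 0`): `r + A w` lies in `(A· + t)''Λ₀` and in the affine twin across the plane through `r`, with three independent exact `A`-slot
neighbours. -/
theorem anchored_of_twinReading_glide (A : EuclideanSpace ℝ (Fin 3) ≃ₗᵢ[ℝ] EuclideanSpace ℝ (Fin 3)) {t r n : EuclideanSpace ℝ (Fin 3)}
    (hread : IsTwinReading X A n r) (hrL : r ∈ (fun q => A q + t) '' fccRef) (hr : r ∈ X)
    {w : EuclideanSpace ℝ (Fin 3)} (hw : w ∈ fccSlots) (hwn : ⟪A w, n⟫_ℝ = 0) :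
    r + A w ∈ (fun q => A q + t) '' fccRef ∧
      r + A w ∈ (fun q => twinFrame A n q + (t + (2 * ⟪r - t, n⟫_ℝ) • n)) '' fccRef ∧
      ∃ a ∈ fccSlots, ∃ b ∈ fccSlots, ∃ c ∈ fccSlots, LinearIndependent ℝ ![a, b, c] ∧
        r + A w + A a ∈ X ∧ r + A w + A b ∈ X ∧ r + A w + A c ∈ X := by
  obtain ⟨⟨hn, hmenu⟩, hown, -, -⟩ := hread
  exact anchored_of_inPlane A hrL hr hn hmenu hown hw hwn

/-- **Step from a FULL ball ⇒ anchored in the same affine lattice.** -/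
theorem anchored_of_isFull_step (A : EuclideanSpace ℝ (Fin 3) ≃ₗᵢ[ℝ] EuclideanSpace ℝ (Fin 3)) {t y : EuclideanSpace ℝ (Fin 3)}
    (hyL : y ∈ (fun q => A q + t) '' fccRef) (hy : y ∈ X) (hfull : IsFull X A y) {w : EuclideanSpace ℝ (Fin 3)} (hw : w ∈ fccSlots) :
    y + A w ∈ (fun q => A q + t) '' fccRef ∧
      ∃ a ∈ fccSlots, ∃ b ∈ fccSlots, ∃ c ∈ fccSlots, LinearIndependent ℝ ![a, b, c] ∧
        y + A w + A a ∈ X ∧ y + A w + A b ∈ X ∧ y + A w + A c ∈ X :=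
  anchored_of_fullShell A hyL hy hfull hw

end ColumnWord

end Summit.Ventures.Crystal3D.Theorems

end
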